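import Summits.HodgeConjecture.HodgeConjecture.Theorems.WeilTypeLadderTensorLocalAnchor
import Summits.HodgeConjecture.HodgeConjecture.Theorems.WeilTypeLadderOnPath
import Literature.AlgebraicGeometry.HodgeTheory.WeilFamilyHodgeSectionAll
import HarnessLib

/-!
# WeilTypeLadder · R1′ and R∞ from local TENSOR anchors, every `K = ℚ(√-d)` (no reach, no discriminant)

b2b cell `hweil`, prover 2 gen 3 (`b2b-hweil-pv2-g3/VARIATIONAL-G3.md` §5b/§6). The all-`d` form of
`Theorems/WeilTypeLadderTensorLocalAnchor.lean`: with the named fact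
`deligne1982_weilFamily_hodgeWeilSection_all` (`Literature/…/WeilFamilyHodgeSectionAll.lean`: Deligne's PEL family
THROUGH an arbitrary Weil-type `(X, Φ)`, `Φ ≫ Φ = -d`, any `d ≥ 1`, with a flat `(k,k)` Weil section and a tensor point;
provenance of the tensor point, packet `GAPS.md` G19: Deligne Thm. 4.8 (b) / [Andre1996Motifs, Lemme 6.3.3] on the SPLIT
components, and in EVERY component the diagonal CM member `E_K^k(ι) × E_K^k(ῑ)` of van Geemen's family
[vanGeemen1994HodgeAV, 5.3–5.7] via the `K`-rational `V₊ = span(e₁, …, e_k)` of the basis (5.4.1) — a routine step not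
printed as such, spelled out in the module docstring of `WeilFamilyFlatSections.lean`)
in place of the route-sector fact, the composition runs for every imaginary quadratic field:

* `weilClass_algebraic_of_deligneAll_of_tensorLocalAnchors` — for `d, k ≥ 1`:
  `deligne1982_weilFamily_hodgeWeilSection_all ∧ HasLocallyAlgebraicTensorAnchors k d ⟹` every rational `(k,k)`
  class of `weilClassesOf X Φ k d` of EVERY abelian `2k`-fold `(X, Φ)` is algebraic — all discriminants (W-engine,
  rationality along the section, local clause at the tensor point, Baire / countable union, Lefschetz on `X`).
* **`nonsplitSixfolds_of_deligneAll_of_tensorLocalAnchors`**: the fact ∧ (`∀ d ≥ 1`, `HasLocallyAlgebraicTensorAnchors 3 d`)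
  ⟹ R1′ (`NonsplitSixfolds`) — the cheapest rung above the floor, reduced to local algebraicity at tensor points with
  NO reach fact and NO discriminant on the carriers; `weilSixfolds_of_deligneAll_of_tensorLocalAnchors` (item
  stmt-HodgeConjecture-2524, all sixfolds).
* **`weilClassesImaginaryQuadratic_of_deligneAll_of_tensorLocalAnchors`**: the fact ∧ (`∀ n ≥ 2, ∀ d ≥ 1`,
  `HasLocallyAlgebraicTensorAnchors n d`) ⟹ R∞ (`WeilClassesImaginaryQuadratic`: Weil 1977 for every imaginary
  quadratic field, every dimension `2n ≥ 4`, every discriminant) — the floor F0a is NOT used.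
* `tensorLocalAnchors_of_hodgeConjecture` — conversely all these predicates hold under HC (landed
  `hasLocallyAlgebraicTensorAnchors_of_hodgeConjecture`), so the reduction loses nothing.

Nothing is asserted (both inputs are hypotheses BY NAME); no definition; sorry-free. Serves stmt-HodgeConjecture-2524.
-/

-- every declaration of this problem lives in `Summit.HodgeConjecture.HodgeConjecture.…` (summit = sub-problem)
set_option linter.dupNamespace false

noncomputable section

open CategoryTheory AlgebraicGeometry Limits MonoidalCategory CartesianMonoidalCategory

namespace Summit.HodgeConjecture.HodgeConjecture.WeilTypeLadder

open Literature.AlgebraicGeometry Literature.AlgebraicGeometry.Motives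
open Literature.AlgebraicGeometry.HodgeTheory
open Literature.AlgebraicTopology.SingularHomology
open Summit.HodgeConjecture.HodgeConjecture.Theorems.HeckePrymWeilLine (stub_rationalAlongSection owf_isoTransport)
open Summit.HodgeConjecture.HodgeConjecture.Theorems.HyperbolicEightfoldsSqrtMinus7.TensorAnchor
  (stub_globalClassEngine)
open Summit.HodgeConjecture.HodgeConjecture.Theorems.HyperbolicEightfoldsSqrtMinus7.AnchorObject
  (complexBetti_map_cupPowTwo cupPowTwo_mem_algebraicClasses_abelian)

/-- **Weil classes of EVERY `ℚ(√-d)`-Weil abelian `2k`-fold — every `d ≥ 1`, every discriminant — from Deligne's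
family through it and locally algebraic TENSOR anchors** (hypotheses BY NAME; nothing asserted). Same mechanism as
`weilClass_algebraic_of_deligne_of_tensorLocalAnchors`; trust base of the family fact off the split components: van
Geemen 5.3–5.7 plus the `K`-rational `V₊ = span(e₁, …, e_k)` of (5.4.1) (packet G19).
[cite: Deligne1982HodgeCycles, proof of Thm. 4.8 (a)–(c)] [cite: vanGeemen1994HodgeAV, §5.3–5.7]
[cite: CharlesSchnell2014Notes, Prop. 11.3.11 (proof)] [cite: VoisinHodgeII2003, §9.2.4 Prop. 9.20] -/
theorem weilClass_algebraic_of_deligneAll_of_tensorLocalAnchors (d k : ℕ) (hd : 0 < d) (hk : 1 ≤ k)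
    (hD : deligne1982_weilFamily_hodgeWeilSection_all) (hT : HasLocallyAlgebraicTensorAnchors k d)
    (X : AbelianVariety ℂ) (Φ : X ⟶ X) (hX : X.dim = 2 * k) (hΦ : Φ ≫ Φ = -((d : ℤ) • 𝟙 X))
    (c : complexBetti X.X (2 * k)) (hcW : c ∈ weilClassesOf X Φ k d) (hcr : IsRationalClass c)
    (hcH : IsOfHodgeType (2 * k) X.X (2 * k) k k c) :
    c ∈ algebraicClasses X.X k := by
  by_cases hc0 : c = 0
  · rw [hc0]; exact Submodule.zero_mem _
  obtain ⟨m, rfl⟩ : ∃ m, k = m + 1 := ⟨k - 1, by omega⟩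
  obtain ⟨𝒳, S, f, s₁, s₀, e, σ, hfam, hemb, hirr, hsm, hSqp, hchart, hσc, hpt, hσH, hσ₁, Y, Ψ, e₀, x, hiso, hσ₀,
      hxW⟩ := hD d hd (m + 1) hk X Φ hX hΦ c hcW hc0 hcr hcH
  haveI := hirr
  obtain ⟨A₁, f₁, g₁, m', hA₁, hYdim, hΨ, hm', hfg, hflat, hg⟩ := hiso
  have h𝒳qp : IsQuasiProjectiveOver 𝒳 := by
    obtain ⟨N, ι, hι, -⟩ := hemb
    haveI := hι
    exact IsQuasiProjectiveOver.of_isClosedImmersion_projectiveSpace_tensor ι hSqp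
  obtain ⟨W, hWσ⟩ :=
    stub_globalClassEngine f (2 * (m + 1)) (2 * (m + 1)) hfam hemb hsm hSqp hirr σ hσc hpt
  have hcls : ∀ (s : ComplexPoints S) (y : complexBetti (fiberOver f s) (2 * (m + 1))),
      σ s = ⟨s, y⟩ → complexBetti.map (fiberι f s) (2 * (m + 1)) W = y := by
    intro s y hy
    have h := (hWσ s).symm.trans hy
    simp only [globalSection, FiberClass.mk.injEq, heq_eq_eq, true_and] at h
    exact h
  have hW₁ : complexBetti.map (fiberι f s₁) (2 * (m + 1)) W = complexBetti.map e.inv (2 * (m + 1)) c :=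
    hcls s₁ _ hσ₁
  have hW₀ : complexBetti.map (fiberι f s₀) (2 * (m + 1)) W = x := hcls s₀ _ hσ₀
  have hrat₁ : IsRationalClass (σ s₁).cls := by rw [hσ₁]; exact hcr.map _
  have hratσ : ∀ s, IsRationalClass (σ s).cls :=
    stub_rationalAlongSection f (2 * (m + 1)) (2 * (m + 1)) hfam hsm hSqp hirr σ hσc hpt s₁ hrat₁
  have hWfib : ∀ s, IsRationalClass (complexBetti.map (fiberι f s) (2 * (m + 1)) W) ∧
      IsOfHodgeType (2 * (m + 1)) (fiberOver f s) (2 * (m + 1)) (m + 1) (m + 1)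
        (complexBetti.map (fiberι f s) (2 * (m + 1)) W) := by
    intro s
    have h1 := hratσ s
    have h2 := hσH s
    rw [hWσ s] at h1 h2
    exact ⟨h1, h2⟩
  have hx' : complexBetti.map e₀.hom (2 * (m + 1)) (complexBetti.map (fiberι f s₀) (2 * (m + 1)) W) =
      complexBetti.map e₀.hom (2 * (m + 1)) x := by rw [hW₀]
  have hxr : IsRationalClass (complexBetti.map e₀.hom (2 * (m + 1)) x) := by
    rw [← hW₀]; exact (hWfib s₀).1.map _
  obtain ⟨U, H, q, hUo, hs₀U, hHfib, hUalg⟩ :=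
    hT Y Ψ hYdim hΨ ⟨A₁, f₁, g₁, m', hA₁, hm', hfg, hflat, hg⟩ _ hxW hxr f hfam h𝒳qp hSqp hirr hsm hchart W hWfib
      s₀ e₀ hx'
  set B : complexBetti 𝒳 (2 * (m + 1)) := ((q : ℚ) : ℂ) • cupPowTwo H (m + 1) + W with hBdef
  have hBres : ∀ s, complexBetti.map (fiberι f s) (2 * (m + 1)) B =
      ((q : ℚ) : ℂ) • cupPowTwo (complexBetti.map (fiberι f s) 2 H) (m + 1) +
        complexBetti.map (fiberι f s) (2 * (m + 1)) W := by
    intro s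
    rw [hBdef, map_add, map_smul, complexBetti_map_cupPowTwo]
  have hBall : ∀ t : ComplexPoints S,
      complexBetti.map (fiberι f t) (2 * (m + 1)) B ∈ algebraicClasses (fiberOver f t) (m + 1) :=
    mem_algebraicClasses_of_isOpen_subset_algebraicityLocus f h𝒳qp hSqp hsm hfam B hUo ⟨s₀, hs₀U⟩
      (fun t ht => by rw [hBres t]; exact hUalg t ht)
  have halg : ((q : ℚ) : ℂ) • cupPowTwo (complexBetti.map (fiberι f s₁) 2 H) (m + 1) +
      complexBetti.map (fiberι f s₁) (2 * (m + 1)) W ∈ algebraicClasses (fiberOver f s₁) (m + 1) := by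
    rw [← hBres s₁]; exact hBall s₁
  have hXsp : IsSmoothProjective (2 * (m + 1)) X.X := isSmoothProjective_of_dim_eq' hX
  have hh₁alg : complexBetti.map e.hom 2 (complexBetti.map (fiberι f s₁) 2 H) ∈ algebraicClasses X.X 1 :=
    lefschetzOneOne_rational_holds hXsp _ ((hHfib s₁).1.map _) ((hHfib s₁).2.map_of_iso e)
  have hh₁k : complexBetti.map e.hom (2 * (m + 1)) (cupPowTwo (complexBetti.map (fiberι f s₁) 2 H) (m + 1)) ∈
      algebraicClasses X.X (m + 1) := by
    rw [complexBetti_map_cupPowTwo]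
    exact cupPowTwo_mem_algebraicClasses_abelian X hh₁alg m
  have hHk : cupPowTwo (complexBetti.map (fiberι f s₁) 2 H) (m + 1) ∈ algebraicClasses (fiberOver f s₁) (m + 1) :=
    owf_isoTransport _ X e (m + 1) _ hh₁k
  have hW₁alg : complexBetti.map e.inv (2 * (m + 1)) c ∈ algebraicClasses (fiberOver f s₁) (m + 1) := by
    rw [← hW₁]
    have h := Submodule.sub_mem _ halg (Submodule.smul_mem _ (((q : ℚ) : ℂ)) hHk)
    rwa [add_sub_cancel_left] at h
  have h := Theorems.isoInvariance_proof e (m + 1) _ hW₁alg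
  rwa [e.complexBetti_map_hom_map_inv] at h

/-! ## R1′, R1 (stmt-2524) and R∞ from local tensor anchors -/

/-- **R1′ (`NonsplitSixfolds`, every `d`) from Deligne's family and locally algebraic tensor anchors in dimension 6** —
no reach fact, no discriminant on the carriers: the NON-SPLIT sixfold rung, the cheapest rung above the floor, is
reduced to local algebraicity of the flat Weil section near the tensor points `Y ~ A₁ × A₁` (for every `d ≥ 1`).
The non-hyperbolicity hypothesis of R1′ is not used (the composition covers every discriminant).
[cite: Deligne1982HodgeCycles, proof of Thm. 4.8 (a)–(c)] [cite: Markman2025SecantWeil, §1.5] -/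
theorem nonsplitSixfolds_of_deligneAll_of_tensorLocalAnchors (hD : deligne1982_weilFamily_hodgeWeilSection_all)
    (hT : ∀ d : ℕ, 0 < d → HasLocallyAlgebraicTensorAnchors 3 d) : NonsplitSixfolds := by
  intro d hd A φ hA _ hφ _ c hc h33 hcW
  have hφ' : φ ≫ φ = -((d : ℤ) • 𝟙 A) := by rw [hφ, natCast_zsmul]
  exact weilClass_algebraic_of_deligneAll_of_tensorLocalAnchors d 3 hd (by norm_num) hD (hT d hd) A φ hA hφ' c hcW
    hc h33

/-- **R1 = item stmt-HodgeConjecture-2524 (`WeilSixfolds`: ALL sixfolds, every `d`, every discriminant) from Deligne's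
family and locally algebraic tensor anchors in dimension 6.** [cite: Deligne1982HodgeCycles, proof of Thm. 4.8 (a)–(c)] -/
theorem weilSixfolds_of_deligneAll_of_tensorLocalAnchors (hD : deligne1982_weilFamily_hodgeWeilSection_all)
    (hT : ∀ d : ℕ, 0 < d → HasLocallyAlgebraicTensorAnchors 3 d) : Theses.SevenfoldWeilCensus.WeilSixfolds := by
  refine weilSixfolds_iff_weilClassesOf.2 ?_
  intro d hd A φ hA _ hφ c hc h33 hcW
  have hφ' : φ ≫ φ = -((d : ℤ) • 𝟙 A) := by rw [hφ, natCast_zsmul]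
  exact weilClass_algebraic_of_deligneAll_of_tensorLocalAnchors d 3 hd (by norm_num) hD (hT d hd) A φ hA hφ' c hcW
    hc h33

/-- **R∞ (`WeilClassesImaginaryQuadratic`: Weil 1977 for every imaginary quadratic field, every `n ≥ 2`, every
discriminant) from Deligne's family and locally algebraic tensor anchors in every dimension** — the floor F0a is not
used, nor any reach fact. [cite: Deligne1982HodgeCycles, proof of Thm. 4.8 (a)–(c)] [cite: Weil1977HodgeRing, §3] -/
theorem weilClassesImaginaryQuadratic_of_deligneAll_of_tensorLocalAnchors
    (hD : deligne1982_weilFamily_hodgeWeilSection_all)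
    (hT : ∀ n : ℕ, 2 ≤ n → ∀ d : ℕ, 0 < d → HasLocallyAlgebraicTensorAnchors n d) :
    WeilClassesImaginaryQuadratic := by
  intro n hn d hd A φ hA _ hφ c hc hnn hcW
  have hφ' : φ ≫ φ = -((d : ℤ) • 𝟙 A) := by rw [hφ, natCast_zsmul]
  exact weilClass_algebraic_of_deligneAll_of_tensorLocalAnchors d n hd (by omega) hD (hT n hn d hd) A φ hA hφ' c hcW
    hc hnn

/-- **Conversely, under HC every tensor predicate holds** (`hasLocallyAlgebraicTensorAnchors_of_hodgeConjecture`),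
so the hypothesis bundle of `weilClassesImaginaryQuadratic_of_deligneAll_of_tensorLocalAnchors` is implied by the
summit: the reduction loses nothing. [folklore] -/
theorem tensorLocalAnchors_of_hodgeConjecture (hHC : _root_.HodgeConjecture) :
    ∀ n : ℕ, 2 ≤ n → ∀ d : ℕ, 0 < d → HasLocallyAlgebraicTensorAnchors n d :=
  fun n _ d _ => hasLocallyAlgebraicTensorAnchors_of_hodgeConjecture hHC n d

end Summit.HodgeConjecture.HodgeConjecture.WeilTypeLadder

end
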